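import Summits.BirchSwinnertonDyer.Rank1Residual.O5.GssTwistDictionary
import Literature.NumberTheory.EllipticCurves.QuadraticTwistJInvariantProofs
import Literature.NumberTheory.EllipticCurves.RootNumberSmulProofs
import Literature.NumberTheory.EllipticCurves.ModularityVersionApProofs
import HarnessLib

/-!
# Route `RamifiedHeegnerPair`, support item `RamifiedTwistSupply` (stmt-BirchSwinnertonDyer-23194):
# stub `stub_goodTwistModel` of the line `supply-imaginary-pair` — the structure of a Gss2 curve at `3`

The checked skeleton `Cruxes/RamifiedPairLowerBound/SupplyViaImaginaryPair.lean` (planner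
bsd-trib-w-rhp g3, commit abe3e481245d) reduces the support item `RamifiedTwistSupply` to five stubs.
This file proves the first one VERBATIM:

`stub_goodTwistModel (W) [W.IsElliptic] [W.IsGloballyMinimal] (hadd : Addv W 3) (hsub : SubGss W 3) :
  ∃ V₀ _ _ C, C • W.quadraticTwist (-3) = V₀ ∧ GoodSS V₀ 3 ∧ ¬ 3 ∣ V₀.conductorNorm ℤ ∧
    (V₀.quadraticTwist (-3)).rootNumber = W.rootNumber`.

Proof: the O5 SUPPLY theorem `O5.exists_goodSS_twist_pStar_of_subGss` (Néron minimal model of `E^{(−3)}`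
+ the `(G) ∧ ss` dictionary at `3`, `O5.subGss_three_iff_subGord_and_goodSS_twist`) gives a globally minimal
`V₀ = C • W^{(−3)}` with `GoodSS V₀ 3`; good reduction at `3` is `3 ∤ N_{V₀}`
(`dvd_conductorNorm_iff_not_hasGoodReductionAtPrime`); and `V₀^{(−3)} = (C • W^{(−3)})^{(−3)}` is
`ℚ`-isomorphic to `W^{(9)} ≅ W^{(1)} ≅ W` (`quadraticTwist_smul`, `quadraticTwist_quadraticTwist`,
`exists_variableChange_quadraticTwist_mul_sq`, `exists_variableChange_quadraticTwist_one`), so the root numbers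
agree (`rootNumber_smul_holds`).

Prover bsd-wall-utd-p3 g8 (cross-route utility inside W-ALL row 2·3@3), 2026-08-28. BSD is not proved by
any of this.
-/

noncomputable section

set_option linter.dupNamespace false

open WeierstrassCurve Literature.NumberTheory.EllipticCurves
  Literature.NumberTheory.EllipticCurves.Rank1Residual
  Summit.BirchSwinnertonDyer.Rank1Residual.Additive
  Summit.BirchSwinnertonDyer.Rank1Residual

namespace Summit.BirchSwinnertonDyer.BirchSwinnertonDyer.Theorems.RamifiedTwistSupplyStubs

/-- **The double `−3`-twist is the curve again, up to `ℚ`-isomorphism**: for any change of variables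
`C`, `(C • W^{(−3)})^{(−3)} = C' • W` for some `C'` (`(−3)·(−3) = 1·3²`). [folklore] -/
theorem exists_variableChange_smul_eq_twist_twist_neg_three (W : WeierstrassCurve ℚ)
    (C : VariableChange ℚ) :
    ∃ C' : VariableChange ℚ, C' • W = (C • W.quadraticTwist (-3)).quadraticTwist (-3) := by
  haveI : NeZero (2 : ℚ) := ⟨two_ne_zero⟩
  obtain ⟨C₁, hC₁⟩ := W.exists_variableChange_quadraticTwist_one
  obtain ⟨C₂, hC₂⟩ := W.exists_variableChange_quadraticTwist_mul_sq 1 (-3) (by norm_num)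
  have h9 : W.quadraticTwist ((-3) * (-3)) = W.quadraticTwist (1 * (-3) ^ 2) := by norm_num
  refine ⟨(⟨C.u, (-3) * C.r, 0, 0⟩ : VariableChange ℚ) * (C₂ * C₁), ?_⟩
  rw [WeierstrassCurve.quadraticTwist_smul, quadraticTwist_quadraticTwist, h9, ← hC₂, ← hC₁]
  simp only [smul_smul]

/-- **Stub `stub_goodTwistModel` of `Cruxes/RamifiedPairLowerBound/SupplyViaImaginaryPair.lean`, verbatim
signature.** A Gss2 curve at `3` (`Addv W 3 ∧ SubGss W 3`) is the `χ₋₃`-twist of a globally minimal `V₀`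
with GOOD supersingular reduction at `3`: `C • W^{(−3)} = V₀`, `GoodSS V₀ 3`, hence `3 ∤ N_{V₀}`, and
`w(V₀^{(−3)}) = w(W)` since `V₀^{(−3)} ≅ W` over `ℚ`. [cite: SilvermanAEC2009, VIII.8.3 and X.5 Cor. 5.4.1]
[cite: Delbourgo1998, §1.5 (G)] -/
theorem goodTwistModel (W : WeierstrassCurve ℚ) [W.IsElliptic] [W.IsGloballyMinimal]
    (hadd : Addv W 3) (hsub : SubGss W 3) :
    ∃ (V₀ : WeierstrassCurve ℚ) (_ : V₀.IsElliptic) (_ : V₀.IsGloballyMinimal)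
      (C : VariableChange ℚ), C • W.quadraticTwist (-3) = V₀ ∧ GoodSS V₀ 3 ∧
      ¬ 3 ∣ V₀.conductorNorm ℤ ∧ (V₀.quadraticTwist (-3)).rootNumber = W.rootNumber := by
  obtain ⟨V₀, hE, hM, C, hC, hss⟩ :=
    O5.exists_goodSS_twist_pStar_of_subGss W 3 (by decide) hadd hsub
  rw [O5.pstar_three] at hC
  refine ⟨V₀, hE, hM, C, hC, hss, ?_, ?_⟩
  · -- good reduction at `3` ⟺ `3 ∤ N`
    exact fun h ↦ (V₀.dvd_conductorNorm_iff_not_hasGoodReductionAtPrime 3).mp h hss.1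
  · -- `V₀^{(−3)} ≅ W`
    obtain ⟨C', hC'⟩ := exists_variableChange_smul_eq_twist_twist_neg_three W C
    rw [← hC, ← hC']
    exact W.rootNumber_smul_holds C'

end Summit.BirchSwinnertonDyer.BirchSwinnertonDyer.Theorems.RamifiedTwistSupplyStubs

end
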